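import Summits.ValiantsHypothesis.ValiantsHypothesis.Theorems.MonotoneRestorationOrbitRestorationQPPieceSigns
import Summits.ValiantsHypothesis.ValiantsHypothesis.Theorems.MonotoneRestorationOrbitRestorationQPKeyCounts
import Summits.ValiantsHypothesis.ValiantsHypothesis.Theorems.MonotoneRestorationOrbitRestorationQPLocalFactors
import HarnessLib

/-!
# Matrix-symmetric affine products: small tools (ORBIT currency, ΠΣ sub-rung)

Route MonotoneRestoration, crux `OrbitRestorationQP` (stmt-ValiantsHypothesis-18293), line `depth-three-rung`,
stub A₁ `stub_piSigmaValue`, namespace `Summit.ValiantsHypothesis.ValiantsHypothesis.Theorems.MatrixAffine`.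

Elementary tools for the parity bookkeeping of rule M2′ (evidence `A1-M2PRIME-PROOF.md` on the crux item):
the identity "transposition" negates nothing, a transposition fixes a set iff it contains both or neither point,
a multiset with even fibres is even, and the fibre-count predicates at a two-element set.  Everything is proved.
[folklore]
-/

noncomputable section

open scoped Classical Pointwise

-- `Summit.ValiantsHypothesis.ValiantsHypothesis.…` is the tree's single-conjunct layout (Sub = Summit).
set_option linter.dupNamespace false

namespace Summit.ValiantsHypothesis.ValiantsHypothesis.Theorems

namespace MatrixAffine

open Equiv Finset ProductAction Literature.Computability.AlgebraicComplexity OrbitRestorationQPDepthThreeRung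

variable {n : ℕ}

/-- A nonzero member of `L` is not negated by the identity "transposition" `(x x)`. [folklore] -/
theorem filter_ren_swap_self_eq_zero {L : Multiset (MvPolynomial (Fin n × Fin n) ℂ)} {a : ℂ}
    (hf0 : MvPolynomial.C a * L.prod ≠ 0) (P : MvPolynomial (Fin n × Fin n) ℂ → Prop) [DecidablePred P] (x : Fin n) :
    Multiset.card ((L.filter P).filter fun ℓ => ren (swap x x) ℓ = -ℓ) = 0 := by
  rw [Multiset.card_eq_zero, Multiset.filter_eq_nil]
  intro ℓ hℓ
  rw [swap_self, show ren (Equiv.refl (Fin n)) ℓ = ℓ from ren_one ℓ]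
  exact SignCount.ne_neg_self (AffineFactors.ne_zero_of_mem hf0 (Multiset.mem_of_mem_filter hℓ))


/-- A transposition fixes a finite set iff it contains both or neither of the two points. [folklore] -/
theorem swap_smul_eq_iff {x y : Fin n} (B : Finset (Fin n)) : swap x y • B = B ↔ (x ∈ B ↔ y ∈ B) := by
  constructor
  · intro h
    constructor
    · intro hx
      have : swap x y • x ∈ swap x y • B := smul_mem_smul_finset hx
      rwa [h, Perm.smul_def, swap_apply_left] at this
    · intro hy
      have : swap x y • y ∈ swap x y • B := smul_mem_smul_finset hy
      rwa [h, Perm.smul_def, swap_apply_right] at this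
  · intro h
    by_cases hx : x ∈ B
    · exact SignFree.swap_smul_finset_eq hx (h.1 hx)
    · have hy : y ∉ B := fun hy => hx (h.2 hy)
      exact KeyedBlocks.smul_eq_of_fix fun z hz =>
        swap_apply_of_ne_of_ne (by rintro rfl; exact hx hz) (by rintro rfl; exact hy hz)

/-- A multiset all of whose fibres under a labelling are even has even cardinality. [folklore] -/
theorem even_card_of_fibres {α β : Type} [DecidableEq β] (g : α → β) :
    ∀ (M : Multiset α), (∀ b, Even (Multiset.card (M.filter fun a => g a = b))) → Even (Multiset.card M) := by
  intro M
  induction h : Multiset.card M using Nat.strong_induction_on generalizing M with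
  | _ N ih =>
    intro hfib
    rcases Multiset.empty_or_exists_mem M with rfl | ⟨a, ha⟩
    · rw [← h]; simp
    · have hsplit := Multiset.filter_add_not (fun c => g c = g a) M
      have hcard : Multiset.card M =
          Multiset.card (M.filter fun c => g c = g a) + Multiset.card (M.filter fun c => ¬g c = g a) := by
        conv_lhs => rw [← hsplit]
        rw [Multiset.card_add]
      have hpos : 0 < Multiset.card (M.filter fun c => g c = g a) :=
        Multiset.card_pos_iff_exists_mem.2 ⟨a, Multiset.mem_filter.2 ⟨ha, rfl⟩⟩
      have hlt : Multiset.card (M.filter fun c => ¬g c = g a) < N := by omega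
      have hrest : Even (Multiset.card (M.filter fun c => ¬g c = g a)) := by
        refine ih _ hlt _ rfl fun b => ?_
        rw [Multiset.filter_filter]
        by_cases hb : b = g a
        · subst hb
          rw [show (M.filter fun c => g c = g a ∧ ¬g c = g a) = 0 from
            Multiset.filter_eq_nil.2 fun c _ hc => hc.2 hc.1]
          simp
        · rw [show (M.filter fun c => g c = b ∧ ¬g c = g a) = M.filter fun c => g c = b from
            Multiset.filter_congr fun c _ => ⟨fun hc => hc.1, fun hc => ⟨hc, by rw [hc]; exact hb⟩⟩]
          exact hfib b
      rw [← h, hcard]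
      exact (hfib (g a)).add hrest

/-- The row count predicate at a two-element set is negation by its transposition. [folklore] -/
theorem pair_rowNeg_iff {x y : Fin n} (hxy : x ≠ y) (ℓ : MvPolynomial (Fin n × Fin n) ℂ) :
    ((({x, y} : Finset (Fin n)).card = 2 ∧ ∀ x' ∈ ({x, y} : Finset (Fin n)), ∀ y' ∈ ({x, y} : Finset (Fin n)),
        x' ≠ y' → vact (K := ℂ) rowHom (swap x' y') ℓ = -ℓ) ↔ vact (K := ℂ) rowHom (swap x y) ℓ = -ℓ) := by
  constructor
  · rintro ⟨-, h⟩
    exact h x (by simp) y (by simp) hxy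
  · intro h
    refine ⟨card_pair hxy, fun x' hx' y' hy' hne => ?_⟩
    simp only [mem_insert, mem_singleton] at hx' hy'
    rcases hx' with rfl | rfl <;> rcases hy' with rfl | rfl
    · exact absurd rfl hne
    · exact h
    · rw [swap_comm]; exact h
    · exact absurd rfl hne

/-- The column count predicate at a two-element set is negation by its transposition. [folklore] -/
theorem pair_colNeg_iff {x y : Fin n} (hxy : x ≠ y) (ℓ : MvPolynomial (Fin n × Fin n) ℂ) :
    ((({x, y} : Finset (Fin n)).card = 2 ∧ ∀ x' ∈ ({x, y} : Finset (Fin n)), ∀ y' ∈ ({x, y} : Finset (Fin n)),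
        x' ≠ y' → vact (K := ℂ) colHom (swap x' y') ℓ = -ℓ) ↔ vact (K := ℂ) colHom (swap x y) ℓ = -ℓ) := by
  constructor
  · rintro ⟨-, h⟩
    exact h x (by simp) y (by simp) hxy
  · intro h
    refine ⟨card_pair hxy, fun x' hx' y' hy' hne => ?_⟩
    simp only [mem_insert, mem_singleton] at hx' hy'
    rcases hx' with rfl | rfl <;> rcases hy' with rfl | rfl
    · exact absurd rfl hne
    · exact h
    · rw [swap_comm]; exact h
    · exact absurd rfl hne


end MatrixAffine

end Summit.ValiantsHypothesis.ValiantsHypothesis.Theorems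

end
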